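import Literature.Probability.RandomPlanarGeometry.HexSAWArmchairWallBridges
import Literature.Probability.RandomPlanarGeometry.HexSAWBrickWallSlabFugacity
import HarnessLib

/-!
# Armchair wall bridges inside Beaton's strips: `B^w_n(y)^{1/(n+3)} ≤ μ_H(y)` for `n ≤ H`, hence
# `β_rot(y) ≤ liminf_H μ_H(y)` for EVERY `y > 0` (the lower half of "`μ_T(1,y) → μ(y)`", Beaton 2014 Proposition 9)

Topic `Literature/Probability/RandomPlanarGeometry` (lane «pcv-sawmu», door «HEX-YC-ROT-LIMIT-ALL-Y», rider I «ROT-SLAB-LOWER»;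
continues `HexSAWArmchairWallBridges.lean` — the armchair wall bridges `wb n`, `WB n y = B^w_n(y)`, the junction concatenation
`jcat` (`jcat_spec`), `wseq`, `armRate`, `eventually_pow_le_wseq` — and `HexSAWBrickWallSlabFugacity.lean` — Beaton's strips of
the ROTATED honeycomb lattice as the column slabs `Slab_H = {0 ≤ x₀ ≤ H}` of the brick wall, `HexBW.slabPairs`, the partition
function `HexBW.slabZ H n y = Ĉ_{H,n}(y,1)` (fugacity on the column `x₀ = 0`) and its growth rate `HexBW.slabMuY H y = μ_H(y)` with
`HexBW.tendsto_slabZ_rpow`).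

Source.  N. R. Beaton, *The critical surface fugacity of self-avoiding walks on a rotated honeycomb lattice*, J. Phys. A 47 (2014)
075003, arXiv:1210.0274v3, §3.2, Proposition 9 (p. 15): "For `y > 0`, `μ_T(1,y) < μ_{T+1}(1,y)`. Moreover, as `T → ∞`,
`μ_T(1,y) → μ(y)`, where `μ(y)` is as defined in Proposition 7." — "The proof is virtually identical to that of Proposition 7 in
[BBdGDCG14]"; there (N. R. Beaton, M. Bousquet-Mélou, J. de Gier, H. Duminil-Copin, A. J. Guttmann, CMP 326 (2014) 727,
arXiv v5 p. 12) the convergence is proved by reference: "The proof that `μ_T(y)` tends to `μ(y)` is analogous to the proof of Theorem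
6.5 in [JvROW06]" (E. J. Janse van Rensburg, E. Orlandini, S. G. Whittington, J. Phys. A 39 (2006) 13869; not held); the from-below
mechanism formalised HERE — wall bridges of a fixed length live in a strip of that width and concatenate inside it — is the device of
Madras–Slade's proof of (8.2.12), eq. (8.2.14) (N. Madras, G. Slade, *The Self-Avoiding Walk* (1993), p. 269), in the armchair frame.
J. M. Hammersley, G. M. Torrie, S. G. Whittington, J. Phys. A 15 (1982) 539, §2.

## The argument (armchair frame)

A wall bridge with `n` steps has all columns in `[0, n]`; the junction concatenation `jcat` of `HexSAWArmchairWallBridges.lean`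
translates the second bridge VERTICALLY only (the junction sits on the wall) and its connector uses the columns `0, 1`, so
column-bounded wall bridges concatenate into column-bounded wall bridges: `WBc n c y ^ (k+1) ≤ WBc (k(n+3)+n) c y` for `c ≥ 1`.
A wall bridge from `0` with columns `≤ H` IS a walk of `Slab_H` started at the cross-section site `0`, with the same column-`0`
visit count, so `WBc N H y ≤ Ĉ_{H,N}(y)`.  Taking `N`-th roots along `N_k = k(n+3)+n` and `k → ∞` (`Ĉ_{H,N}^{1/N} → μ_H(y)`):
**`B^w_n(y)^{1/(n+3)} ≤ μ_H(y)` for `1 ≤ n ≤ H`**, and with `eventually_pow_le_wseq` (`r^{4k} ≤ B^w_{4k−3}(y)` eventually, every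
`r < β_rot(y)`): **for every `r < β_rot(y)`, eventually in `H`, `r ≤ μ_H(y)`**.  (With `μ(y) = β_rot(y)`, rider H, this is the
lower half of Beaton's `μ_T(1,y) → μ(y)`; the upper half `μ_H(y) ≤ μ(y)` is not in this file.)

## Main statements (namespace `…SAW.HexBW.Arm`, all PROVED)

* `wbc`, `WBc`, `wbc_self` (`wbc n n = wb n`), `jcat_mem_wbc`, `mul_WBc_le`, `pow_WBc_le`;
* `leftVisits_zero_eq_visits`, `pair_mem_slabPairs`, **`WBc_le_slabZ`**, `pow_WB_le_slabZ`;
* **`rpow_WB_le_slabMuY : 1 ≤ n → n ≤ H → WB n y ^ (1/(n+3)) ≤ slabMuY H y`**;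
* **`eventually_le_slabMuY : r < armRate y → ∀ᶠ H, r ≤ slabMuY H y`**.
-/

noncomputable section

open Finset Filter Function
open Literature.Probability.LatticeModels Literature.Probability.Percolation SimpleGraph
open _root_.Topology

namespace Literature.Probability.RandomPlanarGeometry.SAW.HexBW.Arm

variable {y : ℝ} {n : ℕ} {c : ℤ} {ω υ : ℕ → Site 2}

/-! ### Column-bounded wall bridges -/

open Classical in
/-- Armchair wall bridges with all columns `≤ c`. [cite: Beaton2014RotatedHoneycomb, §3.2, Proposition 9 (arXiv v3 p. 15: walks confined to a strip of the rotated lattice)] -/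
def wbc (n : ℕ) (c : ℤ) : Finset (ℕ → Site 2) := (wb n).filter fun ω => ∀ i ≤ n, ω i 0 ≤ c

/-- Membership in `wbc`. [cite: Beaton2014RotatedHoneycomb, §3.2, Proposition 9 (arXiv v3 p. 15)] -/
theorem mem_wbc : ω ∈ wbc n c ↔ ω ∈ wb n ∧ ∀ i ≤ n, ω i 0 ≤ c := by
  classical
  exact Finset.mem_filter

/-- **`B^w_{n,c}(y)`**: weighted column-bounded wall bridges. [cite: Beaton2014RotatedHoneycomb, §3.2, Proposition 9 (arXiv v3 p. 15)] -/
def WBc (n : ℕ) (c : ℤ) (y : ℝ) : ℝ := ∑ ω ∈ wbc n c, y ^ visits n ω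

/-- `B^w_{n,c}(y) ≥ 0`. [cite: Beaton2014RotatedHoneycomb, §3.2, Proposition 9 (arXiv v3 p. 15)] -/
theorem WBc_nonneg (n : ℕ) (c : ℤ) (hy : 0 ≤ y) : 0 ≤ WBc n c y := Finset.sum_nonneg fun _ _ => pow_nonneg hy _

/-- A wall bridge with `n` steps has all columns `≤ n`: `wbc n n = wb n`. [cite: MadrasSlade1993, §1.1 (|ω(i)| ≤ i)] -/
theorem wbc_self (n : ℕ) : wbc n n = wb n := by
  classical
  refine Finset.filter_true_of_mem fun ω hω i hi => ?_
  obtain ⟨hs, -, -, -, -⟩ := wb_anatomy hω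
  obtain ⟨h0, -, hadj, -⟩ := Zd.mem_saws.1 (saws_subset _ hs)
  have := Zd.abs_apply_le_of_adj h0 hadj i hi 0
  have hi' : ((i : ℕ) : ℤ) ≤ n := by exact_mod_cast hi
  exact ((abs_le.1 this).2).trans hi'

/-- `B^w_n(y) = B^w_{n,n}(y)`. [cite: MadrasSlade1993, §1.1] -/
theorem WB_eq_WBc (n : ℕ) (y : ℝ) : WB n y = WBc n n y := by rw [WB, WBc, wbc_self]

/-- Monotonicity in the column bound. [cite: Beaton2014RotatedHoneycomb, §3.2, Proposition 9 (arXiv v3 p. 15)] -/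
theorem wbc_mono {c c' : ℤ} (h : c ≤ c') : wbc n c ⊆ wbc n c' := fun ω hω => by
  obtain ⟨hw, hc⟩ := mem_wbc.1 hω
  exact mem_wbc.2 ⟨hw, fun i hi => (hc i hi).trans h⟩

/-- `B^w_{n,c}(y) ≤ B^w_{n,c'}(y)` for `c ≤ c'`. [cite: Beaton2014RotatedHoneycomb, §3.2, Proposition 9 (arXiv v3 p. 15)] -/
theorem WBc_mono {c c' : ℤ} (h : c ≤ c') (hy : 0 ≤ y) : WBc n c y ≤ WBc n c' y :=
  Finset.sum_le_sum_of_subset_of_nonneg (wbc_mono h) fun _ _ _ => pow_nonneg hy _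

/-! ### The junction concatenation keeps the column bound -/

/-- Columns of the tail piece: `0, 1` on the connector, those of `υ` afterwards. [cite: Beaton2014RotatedHoneycomb, §3.1 (arXiv v3 p. 12: the inserted mid-edges at the point of concatenation)] -/
theorem tailPiece_apply_zero_le {n₂ : ℕ} (hυ : υ ∈ wbc n₂ c) (h1 : 1 ≤ c) {j : ℕ} (hj : j ≤ 3 + n₂) : tailPiece υ j 0 ≤ c := by
  obtain ⟨hw, hc⟩ := mem_wbc.1 hυ
  obtain ⟨hs, -, -, -, -⟩ := wb_anatomy hw
  have h0 : υ 0 = 0 := (mem_saws_iff.1 hs).1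
  rcases Nat.lt_or_ge j 3 with hj3 | hj3
  · obtain ⟨⟨v00, -⟩, ⟨v10, -⟩, ⟨v20, -⟩, -⟩ := tailPiece_conn_vals υ h0
    interval_cases j
    · rw [v00]; linarith
    · rw [v10]; exact h1
    · rw [v20]; exact h1
  · rw [tailPiece_apply_of_ge h0 hj3, Pi.add_apply, pt_apply_zero, zero_add]
    exact hc (j - 3) (by omega)

/-- **`jcat` of two column-bounded wall bridges is column-bounded** (`c ≥ 1`). [cite: Beaton2014RotatedHoneycomb, §3.2, Proposition 9 (arXiv v3 p. 15); HammersleyTorrieWhittington1982, §2] -/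
theorem jcat_mem_wbc {n₁ n₂ : ℕ} (hω : ω ∈ wbc n₁ c) (hυ : υ ∈ wbc n₂ c) (h1 : 1 ≤ c) :
    jcat n₁ ω υ ∈ wbc (n₁ + (3 + n₂)) c := by
  obtain ⟨hw, hc⟩ := mem_wbc.1 hω
  obtain ⟨hw₂, -⟩ := mem_wbc.1 hυ
  obtain ⟨-, -, hend, -, -⟩ := wb_anatomy hw
  obtain ⟨hs₂, -, -, -, -⟩ := wb_anatomy hw₂
  have h0 : υ 0 = 0 := (mem_saws_iff.1 hs₂).1
  have ht0 : tailPiece υ 0 = 0 := by rw [tailPiece_apply_of_le υ (Nat.zero_le 3)]; rfl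
  refine mem_wbc.2 ⟨(jcat_spec hw hw₂).1, fun i hi => ?_⟩
  rcases le_or_gt i n₁ with hin | hin
  · rw [jcat, Zd.concatWalk_apply_of_le _ _ hin]; exact hc i hin
  · obtain ⟨j, rfl⟩ : ∃ j, i = n₁ + j := ⟨i - n₁, by omega⟩
    rw [jcat, Zd.concatWalk_apply_add _ _ ht0 j, Pi.add_apply, hend, zero_add]
    exact tailPiece_apply_zero_le hυ h1 (by omega)

/-- **`B^w_{n₁,c}(y) · B^w_{n₂,c}(y) ≤ B^w_{n₁+3+n₂,c}(y)`** (`c ≥ 1`): concatenation inside the strip.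
[cite: Beaton2014RotatedHoneycomb, §3.2, Proposition 9 (arXiv v3 p. 15); HammersleyTorrieWhittington1982, §2; MadrasSlade1993, §8.2, proof of Theorem 8.2.1, (8.2.14) (p. 269)] -/
theorem mul_WBc_le (n₁ n₂ : ℕ) (h1 : 1 ≤ c) (hy : 0 ≤ y) : WBc n₁ c y * WBc n₂ c y ≤ WBc (n₁ + (3 + n₂)) c y := by
  classical
  have hinj : Set.InjOn (fun p : (ℕ → Site 2) × (ℕ → Site 2) => jcat n₁ p.1 p.2) ↑(wbc n₁ c ×ˢ wbc n₂ c) := by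
    rintro ⟨ω, υ⟩ hp ⟨ω', υ'⟩ hp' h
    rw [Finset.mem_coe, Finset.mem_product] at hp hp'
    dsimp only at h
    have hw := (mem_wbc.1 hp.1).1
    have hw' := (mem_wbc.1 hp'.1).1
    have hv := (mem_wbc.1 hp.2).1
    have hv' := (mem_wbc.1 hp'.2).1
    obtain ⟨e1, e2⟩ := Zd.concatWalk_injective_pieces (saws_subset _ (wb_anatomy hw).1) (tailPiece_mem_zd hv)
      (saws_subset _ (wb_anatomy hw').1) (tailPiece_mem_zd hv') h
    have e3 := tailPiece_injective (mem_saws_iff.1 (wb_anatomy hv).1).1 (mem_saws_iff.1 (wb_anatomy hv').1).1 e2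
    simp only [Prod.mk.injEq]
    exact ⟨e1, e3⟩
  calc WBc n₁ c y * WBc n₂ c y
      = ∑ ω ∈ wbc n₁ c, ∑ υ ∈ wbc n₂ c, y ^ visits n₁ ω * y ^ visits n₂ υ := by rw [WBc, WBc, Finset.sum_mul_sum]
    _ = ∑ p ∈ wbc n₁ c ×ˢ wbc n₂ c, y ^ visits (n₁ + (3 + n₂)) (jcat n₁ p.1 p.2) := by
        rw [Finset.sum_product]
        refine Finset.sum_congr rfl fun ω hω => Finset.sum_congr rfl fun υ hυ => ?_
        dsimp only
        rw [(jcat_spec (mem_wbc.1 hω).1 (mem_wbc.1 hυ).1).2, pow_add]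
    _ = ∑ ζ ∈ (wbc n₁ c ×ˢ wbc n₂ c).image (fun p => jcat n₁ p.1 p.2), y ^ visits (n₁ + (3 + n₂)) ζ :=
        (Finset.sum_image (f := fun ζ => y ^ visits (n₁ + (3 + n₂)) ζ) hinj).symm
    _ ≤ WBc (n₁ + (3 + n₂)) c y := by
        refine Finset.sum_le_sum_of_subset_of_nonneg (fun ζ hζ => ?_) fun _ _ _ => pow_nonneg hy _
        obtain ⟨p, hp, rfl⟩ := Finset.mem_image.1 hζ
        rw [Finset.mem_product] at hp
        exact jcat_mem_wbc hp.1 hp.2 h1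

/-- **Powers: `B^w_{n,c}(y)^{k+1} ≤ B^w_{k(n+3)+n, c}(y)`** (`c ≥ 1`). [cite: Beaton2014RotatedHoneycomb, §3.2, Proposition 9 (arXiv v3 p. 15); MadrasSlade1993, §8.2, (8.2.14) (p. 269)] -/
theorem pow_WBc_le (n : ℕ) (h1 : 1 ≤ c) (hy : 0 ≤ y) (k : ℕ) : WBc n c y ^ (k + 1) ≤ WBc (k * (n + 3) + n) c y := by
  induction k with
  | zero => simp
  | succ k ih =>
    calc WBc n c y ^ (k + 1 + 1) = WBc n c y ^ (k + 1) * WBc n c y := pow_succ _ _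
      _ ≤ WBc (k * (n + 3) + n) c y * WBc n c y := mul_le_mul_of_nonneg_right ih (WBc_nonneg n c hy)
      _ ≤ WBc (k * (n + 3) + n + (3 + n)) c y := mul_WBc_le _ _ h1 hy
      _ = WBc ((k + 1) * (n + 3) + n) c y := by rw [show k * (n + 3) + n + (3 + n) = (k + 1) * (n + 3) + n by ring]

/-! ### Wall bridges are walks of the slab -/

/-- The column-`0` count of the slab file, at the start `0`, is the wall-visit count. [cite: Beaton2014RotatedHoneycomb, §3.2, Proposition 8 (arXiv v3 p. 15: vertices in the boundary of the strip)] -/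
theorem leftVisits_zero_eq_visits (ω : ℕ → Site 2) (N : ℕ) : leftVisits 0 ω N = visits N ω := by
  induction N with
  | zero => rw [leftVisits, Finset.sum_range_one, visits_zero, zero_add]
  | succ N ih =>
    rw [leftVisits, Finset.sum_range_succ, visits_succ, ← ih, leftVisits, zero_add]

/-- **A wall bridge from `0` with columns `≤ H` is a walk of `Slab_H`** (started at the cross-section site `0`).
[cite: Beaton2014RotatedHoneycomb, §3.2, Propositions 8–9 (arXiv v3 p. 15)] -/
theorem pair_mem_slabPairs {N H : ℕ} (hω : ω ∈ wbc N (H : ℤ)) : ((0 : Site 2), ω) ∈ slabPairs H N := by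
  obtain ⟨hw, hc⟩ := mem_wbc.1 hω
  obtain ⟨hs, hH, -, -, -⟩ := wb_anatomy hw
  obtain ⟨-, -, hbw, -⟩ := mem_saws_iff.1 hs
  have hstart : (0 : Site 2) ∈ slabStarts H :=
    mem_slabStarts.2 ⟨⟨le_rfl, by simp⟩, le_rfl, by simp⟩
  refine mem_slabPairs.2 ⟨hstart, saws_subset _ hs, fun i hi => by simpa using hbw i hi, fun m hm => ⟨?_, ?_⟩⟩
  · simpa using hH m hm
  · simpa using hc m hm

/-- **`B^w_{N,H}(y) ≤ Ĉ_{H,N}(y)`**. [cite: Beaton2014RotatedHoneycomb, §3.2, Proposition 9 (arXiv v3 p. 15)] -/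
theorem WBc_le_slabZ (N H : ℕ) (hy : 0 ≤ y) : WBc N (H : ℤ) y ≤ slabZ H N y := by
  classical
  have hinj : Set.InjOn (fun ω : ℕ → Site 2 => ((0 : Site 2), ω)) ↑(wbc N (H : ℤ)) := fun _ _ _ _ h => (Prod.mk.inj h).2
  calc WBc N (H : ℤ) y = ∑ ω ∈ wbc N (H : ℤ), y ^ leftVisits (0 : Site 2) ω N := by
        refine Finset.sum_congr rfl fun ω _ => by rw [leftVisits_zero_eq_visits]
    _ = ∑ p ∈ (wbc N (H : ℤ)).image (fun ω => ((0 : Site 2), ω)), y ^ leftVisits p.1 p.2 N :=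
        (Finset.sum_image (f := fun p : Site 2 × (ℕ → Site 2) => y ^ leftVisits p.1 p.2 N) hinj).symm
    _ ≤ slabZ H N y := by
        refine Finset.sum_le_sum_of_subset_of_nonneg (fun p hp => ?_) fun _ _ _ => pow_nonneg hy _
        obtain ⟨ω, hω, rfl⟩ := Finset.mem_image.1 hp
        exact pair_mem_slabPairs hω

/-- **`B^w_n(y)^{k+1} ≤ Ĉ_{H, k(n+3)+n}(y)`** for `1 ≤ n ≤ H`. [cite: Beaton2014RotatedHoneycomb, §3.2, Proposition 9 (arXiv v3 p. 15); MadrasSlade1993, §8.2, (8.2.14) (p. 269)] -/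
theorem pow_WB_le_slabZ (hy : 0 ≤ y) {n H : ℕ} (hn : 1 ≤ n) (hnH : n ≤ H) (k : ℕ) :
    WB n y ^ (k + 1) ≤ slabZ H (k * (n + 3) + n) y := by
  have h1 : (1 : ℤ) ≤ H := by exact_mod_cast hn.trans hnH
  calc WB n y ^ (k + 1) = WBc n n y ^ (k + 1) := by rw [WB_eq_WBc]
    _ ≤ WBc n (H : ℤ) y ^ (k + 1) := pow_le_pow_left₀ (WBc_nonneg n n hy) (WBc_mono (by exact_mod_cast hnH) hy) _
    _ ≤ WBc (k * (n + 3) + n) (H : ℤ) y := pow_WBc_le n h1 hy k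
    _ ≤ slabZ H (k * (n + 3) + n) y := WBc_le_slabZ _ _ hy

/-! ### Rates -/

/-- **`B^w_n(y)^{1/(n+3)} ≤ μ_H(y)` for `1 ≤ n ≤ H`**: wall bridges of a fixed length concatenate inside the strip.
[cite: Beaton2014RotatedHoneycomb, §3.2, Proposition 9 (arXiv v3 p. 15: "as T → ∞, μ_T(1,y) → μ(y)"); HammersleyTorrieWhittington1982, §2] -/
theorem rpow_WB_le_slabMuY (hy : 0 < y) {n H : ℕ} (hn : 1 ≤ n) (hnH : n ≤ H) :
    WB n y ^ (1 / ((n : ℝ) + 3)) ≤ slabMuY H y := by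
  have hH : 1 ≤ H := hn.trans hnH
  set a := WB n y with ha
  have ha0 : 0 ≤ a := WB_nonneg n hy.le
  -- the lengths N_k = k(n+3)+n → ∞ and the exponents (k+1)/N_k → 1/(n+3)
  set Nk : ℕ → ℕ := fun k => k * (n + 3) + n with hNk
  have hNk_top : Tendsto Nk atTop atTop :=
    Filter.tendsto_atTop_mono (fun k => show k ≤ Nk k from by simp only [hNk]; nlinarith) tendsto_id
  have hNk_pos : ∀ k, (0 : ℝ) < Nk k := fun k => by simp only [hNk]; positivity
  have hexp : Tendsto (fun k : ℕ => ((k : ℝ) + 1) / (Nk k : ℝ)) atTop (𝓝 (1 / ((n : ℝ) + 3))) := by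
    have h3 : Tendsto (fun k : ℕ => ((n : ℝ) + 3) - 3 * (1 / ((k : ℝ) + 1))) atTop (𝓝 (((n : ℝ) + 3) - 3 * 0)) :=
      tendsto_const_nhds.sub (tendsto_one_div_add_atTop_nhds_zero_nat.const_mul 3)
    rw [mul_zero, sub_zero] at h3
    have h4 := h3.inv₀ (by positivity : ((n : ℝ) + 3) ≠ 0)
    rw [← one_div] at h4
    refine h4.congr fun k => ?_
    have hN : ((Nk k : ℕ) : ℝ) = ((k : ℝ) + 1) * ((n : ℝ) + 3) - 3 := by simp only [hNk]; push_cast; ring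
    rw [show (n : ℝ) + 3 - 3 * (1 / ((k : ℝ) + 1)) = (((k : ℝ) + 1) * ((n : ℝ) + 3) - 3) / ((k : ℝ) + 1) by
      field_simp, inv_div, hN]
  -- along N_k: a^{(k+1)/N_k} ≤ Ĉ^{1/N_k}
  have hle : ∀ k : ℕ, a ^ (((k : ℝ) + 1) / (Nk k : ℝ)) ≤ slabZ H (Nk k) y ^ (1 / (Nk k : ℝ)) := fun k => by
    have h := pow_WB_le_slabZ hy.le hn hnH k
    have hr := Real.rpow_le_rpow (pow_nonneg ha0 _) h (by positivity : (0 : ℝ) ≤ 1 / (Nk k : ℝ))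
    rw [← Real.rpow_natCast, ← Real.rpow_mul ha0] at hr
    convert hr using 2
    push_cast
    field_simp
  have hlim1 : Tendsto (fun k : ℕ => a ^ (((k : ℝ) + 1) / (Nk k : ℝ))) atTop (𝓝 (a ^ (1 / ((n : ℝ) + 3)))) := by
    rcases ha0.eq_or_lt with h0 | hpos
    · -- a = 0: both sides are 0 (positive exponents)
      have hev : ∀ k : ℕ, a ^ (((k : ℝ) + 1) / (Nk k : ℝ)) = 0 := fun k => by
        rw [← h0, Real.zero_rpow (by have := hNk_pos k; positivity)]
      rw [← h0, Real.zero_rpow (by positivity)]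
      simp only [← h0] at hev
      exact tendsto_const_nhds.congr fun k => (hev k).symm
    · exact tendsto_const_nhds.rpow hexp (Or.inl hpos.ne')
  have hlim2 : Tendsto (fun k : ℕ => slabZ H (Nk k) y ^ (1 / (Nk k : ℝ))) atTop (𝓝 (slabMuY H y)) :=
    (tendsto_slabZ_rpow hH hy).comp hNk_top
  exact le_of_tendsto_of_tendsto hlim1 hlim2 (Filter.Eventually.of_forall hle)

/-- **Locality from below, every `y > 0`: for `r < β_rot(y)`, eventually in `H`, `r ≤ μ_H(y)`** — the armchair wall-bridge rate
(= Beaton's `μ(y)`, by `HexSAWRotSurfaceArmRate.lean`) is at most `liminf_H μ_H(y)`.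
[cite: Beaton2014RotatedHoneycomb, §3.2, Proposition 9 (arXiv v3 p. 15: "as T → ∞, μ_T(1,y) → μ(y)"); HammersleyTorrieWhittington1982, §2] -/
theorem eventually_le_slabMuY (hy : 0 < y) {r : ℝ} (hr : r < armRate y) : ∀ᶠ H : ℕ in atTop, r ≤ slabMuY H y := by
  rcases le_or_gt r 0 with hr0 | hr0
  · refine Filter.eventually_atTop.2 ⟨1, fun H hH => hr0.trans (slabMuY_pos hH hy).le⟩
  obtain ⟨k, hk⟩ := ((eventually_pow_le_wseq hy hr0 hr).and (Filter.eventually_ge_atTop 1)).exists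
  obtain ⟨hk, hk1⟩ := hk
  have hw : wseq y k = WB (4 * k - 3) y := by rw [wseq, if_neg (by omega)]
  rw [hw] at hk
  refine Filter.eventually_atTop.2 ⟨4 * k - 3, fun H hH => ?_⟩
  have h := rpow_WB_le_slabMuY hy (show 1 ≤ 4 * k - 3 by omega) hH
  refine le_trans ?_ h
  -- r = (r^{4k})^{1/(4k)} ≤ (B^w_{4k-3})^{1/(4k-3+3)}
  have hexp : ((4 * k - 3 : ℕ) : ℝ) + 3 = ((4 * k : ℕ) : ℝ) := by push_cast [show 3 ≤ 4 * k by omega]; ring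
  rw [hexp]
  calc r = (r ^ (4 * k)) ^ (1 / ((4 * k : ℕ) : ℝ)) := by
        rw [one_div, Real.pow_rpow_inv_natCast hr0.le (by omega)]
    _ ≤ WB (4 * k - 3) y ^ (1 / ((4 * k : ℕ) : ℝ)) := Real.rpow_le_rpow (pow_nonneg hr0.le _) hk (by positivity)

end Literature.Probability.RandomPlanarGeometry.SAW.HexBW.Arm
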